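import Literature.MathematicalPhysics.QuantumLattice.TorusWilsonMarkov
import Literature.MathematicalPhysics.QuantumLattice.WilsonBlockHeatBathSemigroup
import Literature.MathematicalPhysics.QuantumLattice.WilsonBlockHeatBathLightCone2
import Summits.QuantumFields.YangMills.Theorems.HypercubicLimit.Negative.AllTimesGapFalse

/-!
# Crux `LatticeGapInUVUnits`, line `femto-slab-nondegeneracy`: stub S3 `stub_decayToClustering`

Support file for item stmt-QuantumFields-9366 (route `LangevinControlUV` of `YangMills`), registered stub
`stub_decayToClustering` ("the currency exchange"): for the torus Wilson state `μ = wilsonMeasure r.ρ β` on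
`(ℤ/(2S+1))⁴` (time = axis `0`), GEOMETRIC DECAY `q^j` of the variance of `μ[F | links ≥ jD base layers away
from a time slab]` for bounded measurable slab observables `F` implies EXPONENTIAL CLUSTERING
`|corr_β(A, B, n)| ≤ C(A,B) e^{−(κ/D) n}` for `n ≤ S`, `D ≥ 1`, with `κ = κ(q) > 0` chosen before `A, B` and
`C` uniform in `β, S, D, n`.

Proof (`DecayToClustering.*`): support bookkeeping mod `2S+1` — `A ∘ lift` reads only the slab
`{|t| ≤ M}` and `τ_n B ∘ lift` only links at time distance `≥ jD` from it, `j = ⌊(n − 2M)/D⌋`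
(`WilsonBlockHeatBath.shiftedObservable_props`); the covariance equals the covariance with the conditional
expectation (pull-out property); the elementary inequality `2 s |∫ u v| ≤ ∫ u² + s² ∫ v²` with
`s = e^{−κ j}`, `s² = q₁^j`, `q₁ = max q ½`, `κ = −log q₁ / 2`; the a priori bound `2 C_A C_B`
(`HypercubicLimit.Negative.abs_latticeConnectedCorr_le`) for `n < 2M + D`.  No definition is introduced.
-/

open scoped BigOperators
open MeasureTheory Filter Topology
open Literature.MathematicalPhysics.QuantumFieldTheory Literature.MathematicalPhysics.QuantumLattice
open Literature.MathematicalPhysics.QuantumLattice.WilsonBlockHeatBath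

noncomputable section

namespace Summit.QuantumFields.YangMills.Theorems.LatticeGapInUVUnits.FemtoSlabNondegeneracy

namespace DecayToClustering

/-! ## Part I: an abstract covariance bound on a probability space -/
section Abstract

variable {Ω : Type*} {m : MeasurableSpace Ω} {m0 : MeasurableSpace Ω} {μ : Measure Ω}

/-- Pointwise: `2 s |a b| ≤ a² + s² b²`. -/
theorem two_mul_mul_abs_mul_le (s a b : ℝ) : 2 * s * |a * b| ≤ a ^ 2 + s ^ 2 * b ^ 2 := by
  have h := two_mul_le_add_sq |a| (s * |b|)
  rw [abs_mul]
  calc 2 * s * (|a| * |b|) = 2 * |a| * (s * |b|) := by ring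
    _ ≤ |a| ^ 2 + (s * |b|) ^ 2 := h
    _ = a ^ 2 + s ^ 2 * b ^ 2 := by rw [mul_pow, sq_abs, sq_abs]

/-- `2 s |∫ u v| ≤ ∫ u² + s² ∫ v²` for a.e. bounded `u, v` and `s ≥ 0` (finite measure). -/
theorem two_mul_abs_integral_mul_le [IsFiniteMeasure μ] {u v : Ω → ℝ}
    (hu : AEStronglyMeasurable u μ) (hv : AEStronglyMeasurable v μ) {Mu Mv : ℝ}
    (hbu : ∀ᵐ ω ∂μ, |u ω| ≤ Mu) (hbv : ∀ᵐ ω ∂μ, |v ω| ≤ Mv) {s : ℝ} (hs : 0 ≤ s) :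
    2 * s * |∫ ω, u ω * v ω ∂μ| ≤ (∫ ω, u ω ^ 2 ∂μ) + s ^ 2 * ∫ ω, v ω ^ 2 ∂μ := by
  have huv : Integrable (fun ω => u ω * v ω) μ :=
    (integrable_of_ae_bdd_abs hv hbv).bdd_mul hu (hbu.mono fun ω hω => by rwa [Real.norm_eq_abs])
  have hu2 : Integrable (fun ω => u ω ^ 2) μ := integrable_sq_of_ae_bdd_abs hu hbu
  have hv2 : Integrable (fun ω => v ω ^ 2) μ := integrable_sq_of_ae_bdd_abs hv hbv
  calc 2 * s * |∫ ω, u ω * v ω ∂μ| ≤ 2 * s * ∫ ω, |u ω * v ω| ∂μ :=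
        mul_le_mul_of_nonneg_left abs_integral_le_integral_abs (by positivity)
    _ = ∫ ω, 2 * s * |u ω * v ω| ∂μ := (integral_const_mul _ _).symm
    _ ≤ ∫ ω, (u ω ^ 2 + s ^ 2 * v ω ^ 2) ∂μ :=
        integral_mono (huv.abs.const_mul _) (hu2.add (hv2.const_mul _))
          fun ω => two_mul_mul_abs_mul_le s (u ω) (v ω)
    _ = (∫ ω, u ω ^ 2 ∂μ) + s ^ 2 * ∫ ω, v ω ^ 2 ∂μ := by
        rw [integral_add hu2 (hv2.const_mul _), integral_const_mul]

/-- Centred squares of a function a.e. bounded by `C` integrate to at most `(2C)²` on a probability space. -/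
theorem integral_sq_sub_le [IsProbabilityMeasure μ] {f : Ω → ℝ} (hf : AEStronglyMeasurable f μ)
    {C : ℝ} (hb : ∀ᵐ ω ∂μ, |f ω| ≤ C) {c : ℝ} (hc : |c| ≤ C) :
    ∫ ω, (f ω - c) ^ 2 ∂μ ≤ (2 * C) ^ 2 := by
  have hb' : ∀ᵐ ω ∂μ, |f ω - c| ≤ C + C := ae_abs_sub_le_add hb (ae_of_all _ fun _ => hc)
  have h2 : ∀ᵐ ω ∂μ, (f ω - c) ^ 2 ≤ (2 * C) ^ 2 := hb'.mono fun ω hω => by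
    rw [← sq_abs (f ω - c), show 2 * C = C + C by ring]
    exact pow_le_pow_left₀ (abs_nonneg _) hω 2
  have hm' : AEStronglyMeasurable (fun ω => f ω - c) μ := hf.sub aestronglyMeasurable_const
  calc ∫ ω, (f ω - c) ^ 2 ∂μ ≤ ∫ _, (2 * C) ^ 2 ∂μ :=
        integral_mono_ae (integrable_sq_of_ae_bdd_abs hm' hb') (integrable_const _) h2
    _ = (2 * C) ^ 2 := by simp

/-- **Covariance through a conditional expectation.** On a probability space, if `g` is measurable for the
sub-σ-algebra `m`, `|f| ≤ C_A`, `|g| ≤ C_B`, and the conditional expectation `μ[f|m]` has variance at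
most `ρ · Var f` with `ρ ≤ s²`, `s > 0`, then `|∫ f g − ∫ f ∫ g| ≤ 2 (C_A² + C_B²) s` (pull-out property
and `2 s |∫ u v| ≤ ∫ u² + s² ∫ v²`). -/
theorem abs_cov_le [IsProbabilityMeasure μ] (hm : m ≤ m0) {f g : Ω → ℝ} (hf : AEStronglyMeasurable f μ)
    (hg : StronglyMeasurable[m] g) {CA CB : ℝ} (hfC : ∀ ω, |f ω| ≤ CA) (hgC : ∀ ω, |g ω| ≤ CB)
    {ρ s : ℝ} (hs : 0 < s) (hρs : ρ ≤ s ^ 2)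
    (hdec : ∫ ω, ((μ[f|m]) ω - ∫ x, f x ∂μ) ^ 2 ∂μ ≤ ρ * ∫ ω, (f ω - ∫ x, f x ∂μ) ^ 2 ∂μ) :
    |(∫ ω, f ω * g ω ∂μ) - (∫ ω, f ω ∂μ) * ∫ ω, g ω ∂μ| ≤ 2 * (CA ^ 2 + CB ^ 2) * s := by
  set cA : ℝ := ∫ x, f x ∂μ with hcA
  set cB : ℝ := ∫ x, g x ∂μ with hcB
  have hg0 : AEStronglyMeasurable g μ := (hg.mono hm).aestronglyMeasurable
  have hfi : Integrable f μ := integrable_of_ae_bdd_abs hf (ae_of_all _ hfC)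
  have hgi : Integrable g μ := integrable_of_ae_bdd_abs hg0 (ae_of_all _ hgC)
  have hgC' : ∀ᵐ ω ∂μ, ‖g ω‖ ≤ CB := ae_of_all _ fun ω => by rw [Real.norm_eq_abs]; exact hgC ω
  have hfg : Integrable (f * g) μ := hfi.mul_bdd hg0 hgC'
  have hEb : ∀ᵐ ω ∂μ, |(μ[f|m]) ω| ≤ CA := ae_bdd_abs_condExp_of_ae_bdd_abs (ae_of_all _ hfC)
  have hEi : Integrable (μ[f|m]) μ := integrable_condExp
  have hEg : Integrable (fun ω => (μ[f|m]) ω * g ω) μ := hEi.mul_bdd hg0 hgC'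
  have hcA' : |cA| ≤ CA := by
    have h := norm_integral_le_of_norm_le_const (μ := μ) (f := f) (C := CA)
      (ae_of_all _ fun ω => by rw [Real.norm_eq_abs]; exact hfC ω)
    simpa [Real.norm_eq_abs] using h
  have hcB' : |cB| ≤ CB := by
    have h := norm_integral_le_of_norm_le_const (μ := μ) (f := g) (C := CB) hgC'
    simpa [Real.norm_eq_abs] using h
  -- pull-out: `∫ f g = ∫ μ[f|m] g`
  have hpull : μ[f * g|m] =ᵐ[μ] μ[f|m] * g := condExp_mul_of_stronglyMeasurable_right hg hfg hfi
  have h1 : ∫ ω, f ω * g ω ∂μ = ∫ ω, (μ[f|m]) ω * g ω ∂μ :=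
    calc ∫ ω, f ω * g ω ∂μ = ∫ ω, (f * g) ω ∂μ := rfl
      _ = ∫ ω, (μ[f * g|m]) ω ∂μ := (integral_condExp hm).symm
      _ = ∫ ω, (μ[f|m] * g) ω ∂μ := integral_congr_ae hpull
      _ = ∫ ω, (μ[f|m]) ω * g ω ∂μ := rfl
  have hEint : ∫ ω, (μ[f|m]) ω ∂μ = cA := integral_condExp hm
  -- centring
  set u : Ω → ℝ := fun ω => (μ[f|m]) ω - cA with hu
  set v : Ω → ℝ := fun ω => g ω - cB with hv
  have h2 : ∫ ω, u ω * v ω ∂μ = (∫ ω, (μ[f|m]) ω * g ω ∂μ) - cA * cB := by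
    have e : (fun ω => u ω * v ω) =
        fun ω => ((μ[f|m]) ω * g ω - cB * (μ[f|m]) ω) - (cA * g ω - cA * cB) := by
      funext ω; simp only [hu, hv]; ring
    have i1 : Integrable (fun ω => (μ[f|m]) ω * g ω - cB * (μ[f|m]) ω) μ := hEg.sub (hEi.const_mul cB)
    have i2 : Integrable (fun ω => cA * g ω - cA * cB) μ := (hgi.const_mul cA).sub (integrable_const _)
    rw [e, integral_sub i1 i2, integral_sub hEg (hEi.const_mul cB),
      integral_sub (hgi.const_mul cA) (integrable_const _), integral_const_mul, integral_const_mul, hEint,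
      integral_const, ← hcB, probReal_univ, one_smul]
    ring
  -- the two factors
  have hu_m : AEStronglyMeasurable u μ := hEi.aestronglyMeasurable.sub aestronglyMeasurable_const
  have hv_m : AEStronglyMeasurable v μ := hg0.sub aestronglyMeasurable_const
  have hu_b : ∀ᵐ ω ∂μ, |u ω| ≤ CA + CA := ae_abs_sub_le_add hEb (ae_of_all _ fun _ => hcA')
  have hv_b : ∀ᵐ ω ∂μ, |v ω| ≤ CB + CB := ae_abs_sub_le_add (ae_of_all _ hgC) (ae_of_all _ fun _ => hcB')
  have hnn : 0 ≤ ∫ ω, (f ω - cA) ^ 2 ∂μ := integral_nonneg fun ω => sq_nonneg _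
  have hu2 : ∫ ω, u ω ^ 2 ∂μ ≤ s ^ 2 * (2 * CA) ^ 2 :=
    calc ∫ ω, u ω ^ 2 ∂μ ≤ ρ * ∫ ω, (f ω - cA) ^ 2 ∂μ := hdec
      _ ≤ s ^ 2 * ∫ ω, (f ω - cA) ^ 2 ∂μ := mul_le_mul_of_nonneg_right hρs hnn
      _ ≤ s ^ 2 * (2 * CA) ^ 2 :=
          mul_le_mul_of_nonneg_left (integral_sq_sub_le hf (ae_of_all _ hfC) hcA') (sq_nonneg s)
  have hv2 : ∫ ω, v ω ^ 2 ∂μ ≤ (2 * CB) ^ 2 := integral_sq_sub_le hg0 (ae_of_all _ hgC) hcB'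
  have hcs := two_mul_abs_integral_mul_le hu_m hv_m hu_b hv_b hs.le
  rw [h1, ← h2]
  have h3 : 2 * s * |∫ ω, u ω * v ω ∂μ| ≤ 2 * s * (2 * (CA ^ 2 + CB ^ 2) * s) :=
    calc 2 * s * |∫ ω, u ω * v ω ∂μ| ≤ (∫ ω, u ω ^ 2 ∂μ) + s ^ 2 * ∫ ω, v ω ^ 2 ∂μ := hcs
      _ ≤ s ^ 2 * (2 * CA) ^ 2 + s ^ 2 * (2 * CB) ^ 2 :=
          add_le_add hu2 (mul_le_mul_of_nonneg_left hv2 (sq_nonneg s))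
      _ = 2 * s * (2 * (CA ^ 2 + CB ^ 2) * s) := by ring
  exact le_of_mul_le_mul_left h3 (by positivity)

end Abstract

/-! ## Part II: support bookkeeping on the torus and the main-regime estimate -/
section Lattice

variable {G : Type} [Group G] [TopologicalSpace G] [IsTopologicalGroup G] [CompactSpace G]
  [MeasurableSpace G] [BorelSpace G]

/-- `ZMod` bookkeeping for the slab of `A`: a time `x ∈ [-M, M]` has offset `< 2M+1` from `-M`
on the torus of side `N > 2M`. -/
theorem val_sub_neg_lt {N : ℕ} [NeZero N] {M : ℕ} {x : ℤ} (h0 : 0 ≤ x + M) (h1 : x ≤ M)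
    (hN : 2 * M < N) : (((x : ℤ) : ZMod N) - -((M : ℕ) : ZMod N)).val < 2 * M + 1 := by
  have e : ((x : ℤ) : ZMod N) - -((M : ℕ) : ZMod N) = ((x + M : ℤ) : ZMod N) := by push_cast; ring
  rw [e]
  have h := ZMod.val_intCast (n := N) (x + M)
  rw [Int.emod_eq_of_lt h0 (by omega)] at h
  omega

/-- `ZMod` bookkeeping for the exterior of the widened slab: a time `x` with
`2M + 1 + 2k ≤ x + M + k < N` has offset `≥ 2M + 1 + 2k` from `-M - k`. -/
theorem not_val_sub_lt {N : ℕ} [NeZero N] {M k : ℕ} {x : ℤ} (h0 : (2 * M + 1 + 2 * k : ℤ) ≤ x + M + k)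
    (hN : x + M + k < N) :
    ¬ ((((x : ℤ) : ZMod N) - (-((M : ℕ) : ZMod N) - ((k : ℕ) : ZMod N))).val < 2 * M + 1 + 2 * k) := by
  have e : ((x : ℤ) : ZMod N) - (-((M : ℕ) : ZMod N) - ((k : ℕ) : ZMod N)) = ((x + M + k : ℤ) : ZMod N) := by
    push_cast; ring
  rw [e]
  have h := ZMod.val_intCast (n := N) (x + M + k)
  rw [Int.emod_eq_of_lt (by omega) hN] at h
  omega

/-- **Decay ⇒ clustering, main regime** (`2M + jD ≤ n ≤ S`, `jD ≥ 1`, supports within time `[-M, M]`):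
`|corr_β(A, B, n)| ≤ 2 (C_A² + C_B²) s` whenever `q^j ≤ s²`, `s > 0`, given the conditional-expectation
decay hypothesis at `(β, S, D, q)`. -/
theorem abs_latticeConnectedCorr_le_of_decay (r : LatticeRep G) {q : ℝ} (A B : YMSpecies G) {CA CB : ℝ}
    (hCA : ∀ U, |A.F U| ≤ CA) (hCB : ∀ U, |B.F U| ≤ CB) {M : ℕ} (hM : 1 ≤ M)
    (hMA : ∀ e ∈ A.supp, (e.1 0).natAbs ≤ M) (hMB : ∀ e ∈ B.supp, (e.1 0).natAbs ≤ M)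
    (β : ℝ) {S D n j : ℕ} (hnS : n ≤ S) (hjD : 1 ≤ j * D) (hjn : 2 * M + j * D ≤ n)
    {s : ℝ} (hs : 0 < s) (hqs : q ^ j ≤ s ^ 2)
    (hdec : ∀ (t₀ : ZMod (2 * S + 1)) (w j : ℕ), w + 2 * (j * D) ≤ 2 * S →
      ∀ F : GaugeConfig 4 (2 * S + 1) G → ℝ, Measurable F → (∃ M : ℝ, ∀ U, |F U| ≤ M) →
      DependsOn F {ℓ : Edge 4 (2 * S + 1) | (ℓ.1 0 - t₀).val < w} →
      ∫ U, (((wilsonMeasure (d := 4) (L := 2 * S + 1) r.ρ β)[F|cylinderEvents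
        (X := fun _ : Edge 4 (2 * S + 1) => G) {ℓ : Edge 4 (2 * S + 1) |
          (ℓ.1 0 - (t₀ - ((j * D - 1 : ℕ) : ZMod (2 * S + 1)))).val < w + 2 * (j * D - 1)}ᶜ]) U -
        ∫ V, F V ∂(wilsonMeasure (d := 4) (L := 2 * S + 1) r.ρ β)) ^ 2
          ∂(wilsonMeasure (d := 4) (L := 2 * S + 1) r.ρ β) ≤
      q ^ j * ∫ U, (F U - ∫ V, F V ∂(wilsonMeasure (d := 4) (L := 2 * S + 1) r.ρ β)) ^ 2
        ∂(wilsonMeasure (d := 4) (L := 2 * S + 1) r.ρ β)) :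
    |latticeConnectedCorr r.ρ β (2 * S + 1) A.F B.F n| ≤ 2 * (CA ^ 2 + CB ^ 2) * s := by
  haveI : IsProbabilityMeasure (wilsonMeasure (d := 4) (L := 2 * S + 1) r.ρ β) :=
    isProbabilityMeasure_wilsonMeasure (d := 4) (L := 2 * S + 1) r.ρ r.continuous β
  obtain ⟨hfm, -, -, hfdep⟩ := shiftedObservable_props A ((0 : ℕ) : ℤ) (2 * S + 1)
  obtain ⟨hgm, -, -, hgdep⟩ := shiftedObservable_props B ((n : ℕ) : ℤ) (2 * S + 1)
  rw [latticeConnectedCorr_eq_integral_sub]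
  -- the slab of `A`
  have hsubA : (↑(A.supp.image fun e => torusEdge (2 * S + 1) (e.1 + Pi.single 0 ((0 : ℕ) : ℤ), e.2)) :
      Set (Edge 4 (2 * S + 1))) ⊆
      {ℓ : Edge 4 (2 * S + 1) | (ℓ.1 0 - -((M : ℕ) : ZMod (2 * S + 1))).val < 2 * M + 1} := by
    intro ℓ hℓ
    rw [Finset.coe_image] at hℓ
    obtain ⟨e, he, rfl⟩ := hℓ
    have hb := hMA e (Finset.mem_coe.1 he)
    change ((((e.1 + Pi.single (0 : Fin 4) ((0 : ℕ) : ℤ) : Fin 4 → ℤ) 0 : ℤ) : ZMod (2 * S + 1)) -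
      -((M : ℕ) : ZMod (2 * S + 1))).val < 2 * M + 1
    have e0 : (e.1 + Pi.single (0 : Fin 4) ((0 : ℕ) : ℤ) : Fin 4 → ℤ) 0 = e.1 0 + ((0 : ℕ) : ℤ) := by
      rw [Pi.add_apply, Pi.single_eq_same]
    rw [e0]
    exact val_sub_neg_lt (by omega) (by omega) (by omega)
  have hwj : 2 * M + 1 + 2 * (j * D) ≤ 2 * S := by omega
  have key := hdec (-((M : ℕ) : ZMod (2 * S + 1))) (2 * M + 1) j hwj _ hfm ⟨CA, fun U => hCA _⟩
    (hfdep.mono hsubA)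
  -- `τ_n B` reads only the exterior of the widened slab
  have hsubB : (↑(B.supp.image fun e => torusEdge (2 * S + 1) (e.1 + Pi.single 0 ((n : ℕ) : ℤ), e.2)) :
      Set (Edge 4 (2 * S + 1))) ⊆
      {ℓ : Edge 4 (2 * S + 1) | (ℓ.1 0 - (-((M : ℕ) : ZMod (2 * S + 1)) -
        ((j * D - 1 : ℕ) : ZMod (2 * S + 1)))).val < 2 * M + 1 + 2 * (j * D - 1)}ᶜ := by
    intro ℓ hℓ
    rw [Finset.coe_image] at hℓ
    obtain ⟨e, he, rfl⟩ := hℓ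
    have hb := hMB e (Finset.mem_coe.1 he)
    change ¬ (((((e.1 + Pi.single (0 : Fin 4) ((n : ℕ) : ℤ) : Fin 4 → ℤ) 0 : ℤ) : ZMod (2 * S + 1)) -
      (-((M : ℕ) : ZMod (2 * S + 1)) - ((j * D - 1 : ℕ) : ZMod (2 * S + 1)))).val <
        2 * M + 1 + 2 * (j * D - 1))
    have e0 : (e.1 + Pi.single (0 : Fin 4) ((n : ℕ) : ℤ) : Fin 4 → ℤ) 0 = e.1 0 + ((n : ℕ) : ℤ) := by
      rw [Pi.add_apply, Pi.single_eq_same]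
    rw [e0]
    exact not_val_sub_lt (by omega) (by omega)
  have hgm' : StronglyMeasurable[cylinderEvents (X := fun _ : Edge 4 (2 * S + 1) => G)
      {ℓ : Edge 4 (2 * S + 1) | (ℓ.1 0 - (-((M : ℕ) : ZMod (2 * S + 1)) -
        ((j * D - 1 : ℕ) : ZMod (2 * S + 1)))).val < 2 * M + 1 + 2 * (j * D - 1)}ᶜ]
      (fun U : GaugeConfig 4 (2 * S + 1) G =>
        B.F (configShift (-Pi.single 0 ((n : ℕ) : ℤ)) (torusLift (2 * S + 1) U))) :=
    (hgm.measurable_cylinderEvents_of_dependsOn (hgdep.mono hsubB)).stronglyMeasurable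
  exact abs_cov_le cylinderEvents_le_pi hfm.aestronglyMeasurable hgm' (fun U => hCA _) (fun U => hCB _)
    hs hqs key

end Lattice

end DecayToClustering

open DecayToClustering in
/-- **Stub S3 of line `femto-slab-nondegeneracy`** (decay ⇒ clustering, the currency exchange): for every
`0 ≤ q < 1` there is `κ = κ(q) > 0` such that for every pair of gauge-invariant local observables there is
`C(A,B)` with `|corr_β(A,B,n)| ≤ C e^{−(κ/D) n}` for `n ≤ S`, `D ≥ 1`, whenever the conditional expectations
of bounded slab observables of the torus Wilson state given the links `≥ jD` base layers away decay like
`q^j` in variance. -/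
theorem stub_decayToClustering : ∀ (G : Type) [Group G] [TopologicalSpace G] [IsTopologicalGroup G] [CompactSpace G] [MeasurableSpace G] [BorelSpace G] (r : LatticeRep G) (q : ℝ), 0 ≤ q → q < 1 → ∃ κ : ℝ, 0 < κ ∧ ∀ A B : YMSpecies G, ∃ C : ℝ, ∀ (β : ℝ) (S D n : ℕ) (μ : Measure (GaugeConfig 4 (2 * S + 1) G)), μ = (wilsonMeasure r.ρ β : Measure (GaugeConfig 4 (2 * S + 1) G)) → 1 ≤ D → n ≤ S → (∀ (t₀ : ZMod (2 * S + 1)) (w j : ℕ), w + 2 * (j * D) ≤ 2 * S → ∀ F : GaugeConfig 4 (2 * S + 1) G → ℝ, Measurable F → (∃ M : ℝ, ∀ U, |F U| ≤ M) → DependsOn F {ℓ : Edge 4 (2 * S + 1) | (ℓ.1 0 - t₀).val < w} → ∫ U, ((μ[F|cylinderEvents {ℓ : Edge 4 (2 * S + 1) | (ℓ.1 0 - (t₀ - ((j * D - 1 : ℕ) : ZMod (2 * S + 1)))).val < w + 2 * (j * D - 1)}ᶜ]) U - ∫ V, F V ∂μ) ^ 2 ∂μ ≤ q ^ j * ∫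 U, (F U - ∫ V, F V ∂μ) ^ 2 ∂μ) → |latticeConnectedCorr r.ρ β (2 * S + 1) A.F B.F n| ≤ C * Real.exp (-(κ / D * n)) := by
  intro G _ _ _ _ _ _ r q hq0 hq1
  -- WLOG `q ≥ 1/2`, so that `κ := -log q₁ / 2` is a positive real
  set q₁ : ℝ := max q (1 / 2) with hq₁
  have hq₁0 : 0 < q₁ := lt_max_of_lt_right one_half_pos
  have hq₁1 : q₁ < 1 := max_lt hq1 one_half_lt_one
  have hqq₁ : q ≤ q₁ := le_max_left _ _
  have hlog : Real.log q₁ < 0 := Real.log_neg hq₁0 hq₁1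
  set κ : ℝ := -Real.log q₁ / 2 with hκ
  have hκ0 : 0 < κ := by rw [hκ]; linarith
  have hq₁κ : Real.exp (-2 * κ) = q₁ := by
    rw [hκ, show -2 * (-Real.log q₁ / 2) = Real.log q₁ by ring, Real.exp_log hq₁0]
  refine ⟨κ, hκ0, fun A B => ?_⟩
  obtain ⟨CA, hCA⟩ := A.bounded
  obtain ⟨CB, hCB⟩ := B.bounded
  have hCA0 : 0 ≤ CA := (abs_nonneg _).trans (hCA fun _ => 1)
  have hCB0 : 0 ≤ CB := (abs_nonneg _).trans (hCB fun _ => 1)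
  obtain ⟨M, hM⟩ : ∃ M : ℕ, M = (A.supp ∪ B.supp).sup (fun e => (e.1 0).natAbs) + 1 := ⟨_, rfl⟩
  have hM1 : 1 ≤ M := by omega
  have hMA : ∀ e ∈ A.supp, (e.1 0).natAbs ≤ M := fun e he => by
    rw [hM]
    exact (Finset.le_sup (f := fun e : Literature.MathematicalPhysics.QuantumLattice.ZdEdge 4 =>
      (e.1 0).natAbs) (Finset.mem_union_left _ he)).trans
      (Nat.le_succ _)
  have hMB : ∀ e ∈ B.supp, (e.1 0).natAbs ≤ M := fun e he => by
    rw [hM]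
    exact (Finset.le_sup (f := fun e : Literature.MathematicalPhysics.QuantumLattice.ZdEdge 4 =>
      (e.1 0).natAbs) (Finset.mem_union_right _ he)).trans
      (Nat.le_succ _)
  set K : ℝ := Real.exp (κ * (2 * M + 1)) with hK
  have hK0 : 0 < K := Real.exp_pos _
  refine ⟨(2 * (CA ^ 2 + CB ^ 2) + 2 * (CA * CB)) * K, fun β S D n μ hμ hD hnS hdec => ?_⟩
  subst hμ
  have hD0 : (0 : ℝ) < D := Nat.cast_pos.2 (by omega)
  have hD1 : (1 : ℝ) ≤ D := by exact_mod_cast hD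
  have hMD : (2 * M : ℝ) ≤ 2 * M * D := le_mul_of_one_le_right (by positivity) hD1
  -- exponent comparison, both regimes
  have hexp : ∀ x : ℝ, (n : ℝ) ≤ x * D + (2 * M + 1) * D →
      Real.exp (-(κ * x)) ≤ K * Real.exp (-(κ / D * n)) := by
    intro x hx
    rw [hK, ← Real.exp_add]
    refine Real.exp_le_exp.2 ?_
    have h3 : κ / D * n ≤ κ * x + κ * (2 * M + 1) := by
      rw [div_mul_eq_mul_div, div_le_iff₀ hD0]
      calc κ * n ≤ κ * (x * D + (2 * M + 1) * D) := mul_le_mul_of_nonneg_left hx hκ0.le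
        _ = (κ * x + κ * (2 * M + 1)) * D := by ring
    linarith
  by_cases hn : 2 * M + D ≤ n
  · -- main regime: `j := ⌊(n - 2M)/D⌋ ≥ 1`
    obtain ⟨j, hj⟩ : ∃ j : ℕ, j = (n - 2 * M) / D := ⟨_, rfl⟩
    have hjD : j * D ≤ n - 2 * M := hj ▸ Nat.div_mul_le_self _ _
    have hlt : n - 2 * M < j * D + D := hj ▸ Nat.lt_div_mul_add (by omega)
    have hj1 : 1 ≤ j := by rw [hj, Nat.le_div_iff_mul_le (by omega)]; omega
    have hjD1 : 1 ≤ j * D := Nat.mul_pos (by omega) (by omega)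
    have hjn : 2 * M + j * D ≤ n := by omega
    set s : ℝ := Real.exp (-(κ * j)) with hs
    have hs0 : 0 < s := Real.exp_pos _
    have hqs : q ^ j ≤ s ^ 2 := by
      calc q ^ j ≤ q₁ ^ j := pow_le_pow_left₀ hq0 hqq₁ j
        _ = s ^ 2 := by
          rw [← hq₁κ, hs, ← Real.exp_nat_mul, ← Real.exp_nat_mul]
          congr 1; push_cast; ring
    have hmain := abs_latticeConnectedCorr_le_of_decay r A B hCA hCB hM1 hMA hMB β hnS hjD1 hjn hs0 hqs hdec
    have hsK : s ≤ K * Real.exp (-(κ / D * n)) := hexp j (by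
      have h1 : ((n - 2 * M : ℕ) : ℝ) < j * D + D := by exact_mod_cast hlt
      rw [Nat.cast_sub (by omega)] at h1
      push_cast at h1
      linarith)
    have hnonneg : 0 ≤ 2 * (CA * CB) * K * Real.exp (-(κ / D * n)) := by positivity
    calc |latticeConnectedCorr r.ρ β (2 * S + 1) A.F B.F n| ≤ 2 * (CA ^ 2 + CB ^ 2) * s := hmain
      _ ≤ 2 * (CA ^ 2 + CB ^ 2) * (K * Real.exp (-(κ / D * n))) :=
          mul_le_mul_of_nonneg_left hsK (by positivity)
      _ ≤ (2 * (CA ^ 2 + CB ^ 2) + 2 * (CA * CB)) * K * Real.exp (-(κ / D * n)) := by linarith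
  · -- small separations: the a priori bound
    have hap := Summit.QuantumFields.YangMills.Theorems.HypercubicLimit.Negative.abs_latticeConnectedCorr_le
      r β (2 * S + 1) hCA hCB n
    have h1K : 1 ≤ K * Real.exp (-(κ / D * n)) := by
      have h := hexp 0 (by
        have : (n : ℝ) < 2 * M + D := by exact_mod_cast Nat.lt_of_not_le hn
        linarith)
      simpa using h
    have hnonneg : 0 ≤ 2 * (CA ^ 2 + CB ^ 2) * K * Real.exp (-(κ / D * n)) := by positivity
    calc |latticeConnectedCorr r.ρ β (2 * S + 1) A.F B.F n| ≤ 2 * (CA * CB) := hap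
      _ ≤ 2 * (CA * CB) * (K * Real.exp (-(κ / D * n))) := le_mul_of_one_le_right (by positivity) h1K
      _ ≤ (2 * (CA ^ 2 + CB ^ 2) + 2 * (CA * CB)) * K * Real.exp (-(κ / D * n)) := by linarith

end Summit.QuantumFields.YangMills.Theorems.LatticeGapInUVUnits.FemtoSlabNondegeneracy

end
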